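import Summits.ResolutionOfSingularities.ResolutionOfSingularities.Theorems.WeightedInvariantKWildHomDrop
import Summits.ResolutionOfSingularities.ResolutionOfSingularities.Theorems.WeightedInvariantContactCylinderGenericSuccessor
import HarnessLib

/-!
# `t`-HOMOGENEITY of the successor's prime from a graded section model (ring level)

Route `ResolutionOfSingularities/WeightedInvariant`, crux `Theses.WeightedInvariant.HypersurfaceCentreConstruction`
(stmt-ResolutionOfSingularities-19897), door line `local-engine`, E2 tier (S-b2-over) (res-L1-w43-plan-1 SPEC (Δ6b) rev 6, OFFER (o59-b2-over)):
the `IsTHomogeneous u w 𝔫` clause of `Stage.SuccOverCentreAt` (…ELadderTwoCompatible), ring-level core.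

* `rho_single_mem_of_mem` — GRADED BOOKKEEPING.  `S = ⊕ 𝒥ₙ tⁿ` the chart algebra, `ρ : S → Γ` a ring map into a `ℤ`-GRADED ring `Γ` (the
  sections of `B₊` over a successor chart, graded by the LAST coordinate of its `ℤʲ⁺¹`-grading) with `ρ (a·1)` of degree `0` and `ρ t⁻¹`
  of degree `−1`, `P ⊆ Γ` a HOMOGENEOUS ideal which is the contraction of an ideal `𝔪` along `g : Γ → O` into a DOMAIN `O` with
  `g (ρ t⁻¹) ≠ 0` (the germ at the read point: `𝒪_{B₊,η'}` is regular, `t⁻¹ ≠ 0` there).  THEN `ρ z ∈ P` forces `ρ (z_d tᵈ) ∈ P` for every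
  `t`-component `z_d tᵈ` of `z`: multiply by `(ρ t⁻¹)^N` to bring `z` to non-positive degrees, where the degrees of the images are known,
  compare the homogeneous components of `ρ z` and `ρ (z tᵈ-part)` after multiplication by the homogeneous element `(ρ t⁻¹)^N`, and cancel it in
  the domain `O`.
* `isTHomogeneous_of_forall_single_mem` — TRANSFER to the game-side carrier: if the coefficientwise localisation `ℓ : S → S₀[t⁻¹, 𝒥ₙ' tⁿ]`
  (…PlusStalkGameSideCoeff) reaches every element up to a unit `ℓ (m·1)` and `ℓ z ∈ 𝔫 ⇒ ℓ (z_d tᵈ) ∈ 𝔫` for all `d`, then `𝔫` is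
  `t`-homogeneous (`IsTHomogeneous`, …KWildHomDrop).
Pure algebra, def-free; OURS bookkeeping; nothing here is a claim about Hironaka's problem; AI-written, weaker than expert review.
[cite: Wlodarczyk2022, Def. 5.1.1; 3.3.12]
-/

noncomputable section

set_option linter.dupNamespace false -- mandated namespace of this single-conjunct summit

open scoped LaurentPolynomial
open LaurentPolynomial DirectSum
open Literature.AlgebraicGeometry.Resolution
open Summit.ResolutionOfSingularities.ResolutionOfSingularities.Theorems

namespace Summit.ResolutionOfSingularities.ResolutionOfSingularities.Cruxes.HypersurfaceCentreConstruction.LocalEngine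

/-! ## Laurent bookkeeping -/

section Laurent

variable {A : Type} [CommRing A]

/-- A monomial of non-positive degree `−k` is `C a · (t⁻¹)ᵏ`. [folklore] -/
theorem single_neg_eq_C_mul_T_pow (a : A) (k : ℕ) :
    (AddMonoidAlgebra.single (-(k : ℤ)) a : A[T;T⁻¹]) = C a * T (-1) ^ k := by
  rw [single_eq_C_mul_T, T_pow, mul_neg, mul_one]

/-- The `t`-component of degree `d` of an element of `⊕ 𝒥ₙ tⁿ`, as an element of `⊕ 𝒥ₙ tⁿ`. [folklore] -/
theorem single_coeff_mem (F : IdealFiltration A) (z : F.extendedRees) (d : ℤ) :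
    (AddMonoidAlgebra.single d ((z : A[T;T⁻¹]).coeff d) : A[T;T⁻¹]) ∈ F.extendedRees :=
  KWildHom.single_coeff_mem_extendedRees F z.2 d

end Laurent

/-! ## Graded bookkeeping: `ρ z ∈ P ⇒ ρ (z_d tᵈ) ∈ P` -/

section Graded

variable {A : Type} [CommRing A] (F : IdealFiltration A)
  {Γ : Type} [CommRing Γ] (ℬ : ℤ → AddSubgroup Γ) [GradedRing ℬ]
  (ρ : F.extendedRees →+* Γ)

/-- **GRADED BOOKKEEPING.**  `ρ : ⊕ 𝒥ₙ tⁿ → Γ` into a `ℤ`-graded ring with `ρ (a·1) ∈ Γ₀`, `ρ t⁻¹ ∈ Γ₋₁`; `P = g⁻¹ 𝔪` homogeneous, `g : Γ → O`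
into a domain with `g (ρ t⁻¹) ≠ 0`.  If `ρ z ∈ P` then `ρ (z_d tᵈ) ∈ P` for every `d`. [folklore] -/
theorem rho_single_mem_of_mem
    (hρC : ∀ a : A, ρ (algebraMap A F.extendedRees a) ∈ ℬ 0)
    (hρT : ρ ⟨T (-1), F.T_neg_one_mem_extendedRees⟩ ∈ ℬ (-1))
    {P : Ideal Γ} (hP : P.IsHomogeneous ℬ)
    {O : Type} [CommRing O] [IsDomain O] (g : Γ →+* O) (𝔪 : Ideal O) (hPg : P = 𝔪.comap g)
    (hT0 : g (ρ ⟨T (-1), F.T_neg_one_mem_extendedRees⟩) ≠ 0)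
    {z : F.extendedRees} (hz : ρ z ∈ P) (d : ℤ) :
    ρ ⟨AddMonoidAlgebra.single d ((z : A[T;T⁻¹]).coeff d), single_coeff_mem F z d⟩ ∈ P := by
  classical
  set tS : F.extendedRees := ⟨T (-1), F.T_neg_one_mem_extendedRees⟩ with htS
  -- a bound `N` on the support of `z`
  obtain ⟨N, hN⟩ : ∃ N : ℕ, ∀ e ∈ (z : A[T;T⁻¹]).coeff.support, e ≤ N := by
    obtain ⟨N, hN⟩ := ((z : A[T;T⁻¹]).coeff.support.image Int.toNat).exists_le
    exact ⟨N, fun e he => (Int.self_le_toNat e).trans (Int.ofNat_le.mpr (hN _ (Finset.mem_image_of_mem _ he)))⟩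
  -- `w := z · (t⁻¹)^N` has support in degrees `≤ 0`; its components
  set w : F.extendedRees := z * tS ^ N with hw
  have hwcoe : (w : A[T;T⁻¹]) = (z : A[T;T⁻¹]) * T (-(N : ℤ)) := by
    rw [hw, Subalgebra.coe_mul, Subalgebra.coe_pow, htS, Subtype.coe_mk, T_pow, mul_neg, mul_one]
  have hwcoeff : ∀ e : ℤ, (w : A[T;T⁻¹]).coeff e = (z : A[T;T⁻¹]).coeff (e + N) := fun e => by
    rw [hwcoe, ContactCylinder.coeff_mul_T, sub_neg_eq_add]
  have hwsupp : ∀ e ∈ (w : A[T;T⁻¹]).coeff.support, e ≤ 0 := fun e he => by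
    rw [Finsupp.mem_support_iff, hwcoeff] at he
    have h := hN (e + N) (Finsupp.mem_support_iff.mpr he)
    omega
  -- the component `w_e`, `e ≤ 0`, maps into `ℬ e`
  let wc : ℤ → F.extendedRees := fun e => ⟨AddMonoidAlgebra.single e ((w : A[T;T⁻¹]).coeff e), single_coeff_mem F w e⟩
  have hwc_mem : ∀ e : ℤ, e ≤ 0 → ρ (wc e) ∈ ℬ e := by
    intro e he
    obtain ⟨k, hk⟩ := Int.exists_eq_neg_ofNat he
    have hwce : wc e = algebraMap A F.extendedRees ((w : A[T;T⁻¹]).coeff e) * tS ^ k := by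
      apply Subtype.ext
      rw [Subalgebra.coe_mul, Subalgebra.coe_pow, Subalgebra.coe_algebraMap, htS, Subtype.coe_mk, ← C_eq_algebraMap,
        ← single_neg_eq_C_mul_T_pow, ← hk]
    rw [hwce, map_mul, map_pow]
    have h2 : ρ tS ^ k ∈ ℬ (-(k : ℤ)) := by
      have h := SetLike.pow_mem_graded k hρT
      rwa [nsmul_eq_mul, mul_neg, mul_one] at h
    have h3 := SetLike.mul_mem_graded (hρC ((w : A[T;T⁻¹]).coeff e)) h2
    rwa [zero_add, ← hk] at h3
  -- `w = Σ_e w_e`, hence `ρ w = Σ_e ρ w_e`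
  have hwsum : w = ∑ e ∈ (w : A[T;T⁻¹]).coeff.support, wc e := by
    apply Subtype.ext
    rw [AddSubmonoidClass.coe_finsetSum]
    change (w : A[T;T⁻¹]) = ∑ e ∈ (w : A[T;T⁻¹]).coeff.support, AddMonoidAlgebra.single e ((w : A[T;T⁻¹]).coeff e)
    conv_lhs => rw [← AddMonoidAlgebra.sum_coeff_single (w : A[T;T⁻¹])]
    rfl
  -- the `(d − N)`-component of `ρ w` is `ρ (w_{d−N})`
  have hcomp : (decompose ℬ (ρ w) (d - N) : Γ) = ρ (wc (d - N)) := by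
    have h1 : ρ w = ∑ e ∈ (w : A[T;T⁻¹]).coeff.support, ρ (wc e) := by
      conv_lhs => rw [hwsum]
      rw [map_sum]
    rw [← GradedRing.proj_apply, h1, map_sum]
    simp_rw [GradedRing.proj_apply]
    by_cases hd : (d - N : ℤ) ∈ (w : A[T;T⁻¹]).coeff.support
    · rw [Finset.sum_eq_single (d - N : ℤ)]
      · exact decompose_of_mem_same ℬ (hwc_mem _ (hwsupp _ hd))
      · intro e he hne
        exact decompose_of_mem_ne ℬ (hwc_mem e (hwsupp e he)) hne
      · intro h; exact absurd hd h
    · have hzero : wc (d - N) = 0 := by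
        apply Subtype.ext
        change AddMonoidAlgebra.single (d - (N : ℤ)) ((w : A[T;T⁻¹]).coeff (d - N)) = 0
        rw [Finsupp.notMem_support_iff.mp hd, AddMonoidAlgebra.single_zero]
      rw [hzero, map_zero]
      refine Finset.sum_eq_zero fun e he => ?_
      exact decompose_of_mem_ne ℬ (hwc_mem e (hwsupp e he)) fun h => hd (h ▸ he)
  -- `w_{d−N} = z_d · (t⁻¹)^N`
  have hwcz : wc (d - N) = ⟨AddMonoidAlgebra.single d ((z : A[T;T⁻¹]).coeff d), single_coeff_mem F z d⟩ * tS ^ N := by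
    apply Subtype.ext
    rw [Subalgebra.coe_mul, Subalgebra.coe_pow, htS, Subtype.coe_mk]
    change AddMonoidAlgebra.single (d - (N : ℤ)) ((w : A[T;T⁻¹]).coeff (d - N)) =
      AddMonoidAlgebra.single d ((z : A[T;T⁻¹]).coeff d) * T (-1) ^ N
    rw [hwcoeff, sub_add_cancel, T_pow, mul_neg, mul_one, single_eq_C_mul_T, single_eq_C_mul_T, mul_assoc, ← T_add,
      ← sub_eq_add_neg]
  -- the `(d + (−N))`-component of `ρ z · (ρ t⁻¹)^N` is `(ρ z)_d · (ρ t⁻¹)^N`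
  have hvN : ρ tS ^ N ∈ ℬ (-(N : ℤ)) := by
    have h := SetLike.pow_mem_graded N hρT
    rwa [nsmul_eq_mul, mul_neg, mul_one] at h
  have hcomp' : (decompose ℬ (ρ w) (d - N) : Γ) = (decompose ℬ (ρ z) d : Γ) * ρ tS ^ N := by
    rw [hw, map_mul, map_pow, sub_eq_add_neg]
    exact coe_decompose_mul_add_of_right_mem ℬ hvN
  -- cancel `(g ρ t⁻¹)^N` in the domain `O`
  have hkey : g (decompose ℬ (ρ z) d : Γ) = g (ρ ⟨AddMonoidAlgebra.single d ((z : A[T;T⁻¹]).coeff d), single_coeff_mem F z d⟩) := by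
    have h : (decompose ℬ (ρ z) d : Γ) * ρ tS ^ N =
        ρ ⟨AddMonoidAlgebra.single d ((z : A[T;T⁻¹]).coeff d), single_coeff_mem F z d⟩ * ρ tS ^ N := by
      rw [← hcomp', hcomp, hwcz, map_mul, map_pow]
    have h' := congrArg g h
    rw [map_mul, map_mul, map_pow] at h'
    exact mul_right_cancel₀ (pow_ne_zero N hT0) h'
  -- `(ρ z)_d ∈ P` by homogeneity, hence its twin along `g`
  have hmem : (decompose ℬ (ρ z) d : Γ) ∈ P := (hP.mem_iff.mp hz) d
  rw [hPg, Ideal.mem_comap] at hmem ⊢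
  rwa [hkey] at hmem

end Graded

/-! ## Transfer to the game-side carrier: `t`-homogeneity of `𝔫` -/

section Transfer

variable {A : Type} [CommRing A] (F : IdealFiltration A)
  {O : Type} [CommRing O] [Algebra A O] {n : ℕ} (u : Fin n → O) (w : Fin n → ℕ)
  (ℓ : F.extendedRees →+* cobordantAlgebra' u w)

/-- **`t`-HOMOGENEITY OF `𝔫` from the splitting along the coefficient map.**  If `ℓ : ⊕ 𝒥ₙ tⁿ → S₀[t⁻¹, 𝒥ₙ' tⁿ]` is coefficientwise
(`a tⁿ ↦ (a/1) tⁿ`), every element of the carrier is `ℓ z · (ℓ (m·1))⁻¹` for a unit `ℓ (m·1)`, and `ℓ z ∈ 𝔫 ⇒ ℓ (z_d tᵈ) ∈ 𝔫` for all `d`,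
then `𝔫` is `t`-homogeneous. [folklore] -/
theorem isTHomogeneous_of_forall_single_mem (𝔫 : Ideal (cobordantAlgebra' u w))
    (hℓcoe : ∀ z : F.extendedRees, ((ℓ z : cobordantAlgebra' u w) : O[T;T⁻¹]) =
      AddMonoidAlgebra.mapRingHom ℤ (algebraMap A O) (z : A[T;T⁻¹]))
    (hsurj : ∀ c : cobordantAlgebra' u w, ∃ (z : F.extendedRees) (m : A), IsUnit (ℓ (algebraMap A F.extendedRees m)) ∧
      c * ℓ (algebraMap A F.extendedRees m) = ℓ z)
    (hsplit : ∀ z : F.extendedRees, ℓ z ∈ 𝔫 → ∀ d : ℤ,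
      ℓ ⟨AddMonoidAlgebra.single d ((z : A[T;T⁻¹]).coeff d), single_coeff_mem F z d⟩ ∈ 𝔫) :
    IsTHomogeneous u w 𝔫 := by
  classical
  apply le_antisymm
  · exact Ideal.span_le.mpr fun x hx => hx.1
  · intro x hx
    obtain ⟨z, m, hunit, hzm⟩ := hsurj x
    -- the components of `x`
    let xc : ℤ → cobordantAlgebra' u w := fun d =>
      ⟨AddMonoidAlgebra.single d ((x : O[T;T⁻¹]).coeff d), KWildHom.single_coeff_mem_extReesAlgebra u w x.2 d⟩
    -- `ℓ (z_d tᵈ) = x_d · ℓ (m·1)`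
    have hm : ((ℓ (algebraMap A F.extendedRees m) : cobordantAlgebra' u w) : O[T;T⁻¹]) = C (algebraMap A O m) := by
      rw [hℓcoe, Subalgebra.coe_algebraMap, ← C_eq_algebraMap, ← single_eq_C, AddMonoidAlgebra.mapRingHom_single, single_eq_C]
    have hcoeff : ∀ d : ℤ, algebraMap A O ((z : A[T;T⁻¹]).coeff d) = (x : O[T;T⁻¹]).coeff d * algebraMap A O m := fun d => by
      have h := congrArg (fun c : cobordantAlgebra' u w => (c : O[T;T⁻¹]).coeff d) hzm
      simp only [Subalgebra.coe_mul, hm, hℓcoe, AddMonoidAlgebra.coeff_mapRingHom] at h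
      rw [← h, mul_comm, ← smul_eq_C_mul, AddMonoidAlgebra.coeff_smul_apply, smul_eq_mul, mul_comm]
    have hxd : ∀ d : ℤ, ℓ ⟨AddMonoidAlgebra.single d ((z : A[T;T⁻¹]).coeff d), single_coeff_mem F z d⟩ =
        xc d * ℓ (algebraMap A F.extendedRees m) := fun d => by
      apply Subtype.ext
      rw [Subalgebra.coe_mul, hm, hℓcoe]
      show AddMonoidAlgebra.mapRingHom ℤ (algebraMap A O) (AddMonoidAlgebra.single d ((z : A[T;T⁻¹]).coeff d)) =
        AddMonoidAlgebra.single d ((x : O[T;T⁻¹]).coeff d) * C (algebraMap A O m)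
      rw [AddMonoidAlgebra.mapRingHom_single, hcoeff, single_eq_C_mul_T, single_eq_C_mul_T, map_mul]
      ring
    -- each component of `x` lies in `𝔫`
    have hxmem : ∀ d : ℤ, xc d ∈ 𝔫 := fun d => by
      have h1 : ℓ z ∈ 𝔫 := by rw [← hzm]; exact Ideal.mul_mem_right _ _ hx
      have h2 := hsplit z h1 d
      rw [hxd] at h2
      exact (Ideal.mul_unit_mem_iff_mem 𝔫 hunit).mp h2
    -- `x = Σ_d x_d`
    have hxsum : x = ∑ d ∈ (x : O[T;T⁻¹]).coeff.support, xc d := by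
      apply Subtype.ext
      rw [AddSubmonoidClass.coe_finsetSum]
      change (x : O[T;T⁻¹]) = ∑ d ∈ (x : O[T;T⁻¹]).coeff.support, AddMonoidAlgebra.single d ((x : O[T;T⁻¹]).coeff d)
      conv_lhs => rw [← AddMonoidAlgebra.sum_coeff_single (x : O[T;T⁻¹])]
      rfl
    rw [hxsum]
    refine Ideal.sum_mem _ fun d _ => Ideal.subset_span ⟨hxmem d, d, ?_⟩
    rw [KWildHom.mem_tPiece_iff]
    exact AddMonoidAlgebra.single_mem_grade _ _

end Transfer

end Summit.ResolutionOfSingularities.ResolutionOfSingularities.Cruxes.HypersurfaceCentreConstruction.LocalEngine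

end
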